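import Summits.AtomisticToContinuum.Crystallization.Theorems.FreeSplittingCertificatesRadiusLadderPeriodicHalf
import Literature.MathematicalPhysics.StatisticalMechanics.HcpSiteGeometry

/-!
# `FiniteRangeSplitting` (stmt-AtomisticToContinuum-12559): hcp fragments never refute — the half rule, by name

Companion of `FreeSplittingCertificatesRadiusLadderPeriodicHalf` (block-2b unit `b2b-freesplit-A`, gen 7).
VALUE = a theorem retiring, BY NAME and at every radius, the binding family of the R = 2 recurrent-pattern LP
(the hcp balls `hcp_ball_r6(a*)`, RESULTS-R2 §6 P11) as stand-alone refuters of the radius ladder — NOT summit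
progress; nothing here closes an item.

`halfRule_feasibleOn_periodic` (gen 6) needs two hypotheses on the periodic configuration `P`:
SITE-HOMOGENEITY (`latticeSiteSum P y = latticeSiteSum P y'` on the motif — automatic only for Bravais
lattices) and ATTRACTIVITY (every realised pair energy `≤ 0`).  The hexagonal close packing is not a Bravais
lattice (motif of two points), so gen 6 left its homogeneity "to be supplied by the user".  This file supplies
it from the tree's vertex-transitivity of hcp (`Literature…HcpHomogeneous`:
`hcpPeriodicConfiguration_homogeneous` — every point `p₀` carries a LINEAR ISOMETRY `B` with
`q ∈ hcp ↔ p₀ + B q ∈ hcp`), via a general transport lemma valid for any periodic configuration: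

* `latticeSiteSum_eq_originSiteSum` — an isometric symmetry `q ↦ p₀ + B q` of the point set onto itself
  transports the site sum at `p₀` to the origin sum `Σ'_{q ∈ F+G, q ≠ 0} V_LJ(‖q‖)` (reindexing an
  absolutely convergent `tsum` along the induced `Equiv`, `‖B q‖ = ‖q‖`); hence
* `latticeSiteSum_hom_of_homogeneous` — an isometrically homogeneous (vertex-transitive) periodic point set is
  site-homogeneous, and `attractive_of_homogeneous` — it is attractive as soon as `V_LJ(‖q‖) ≤ 0` at its
  non-zero points (all pair distances are distances from the origin);
* `hcp_min_le_norm_sq` — the squared norms of the non-zero hcp sites `(k, i, j) ≠ 0` of `hcpStacking a h`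
  (in-layer spacing `a`, layer height `h`, no hypothesis on `a, h`) are
  `≥ min (min a² (4 h²)) (a²/3 + h²)` (in-layer form `i² + ij + j² ≥ 1`; odd layers: the INTEGER
  `i² + ij + j² + i + j` is `≥ -1/3`, hence `≥ 0`; even layers `k ≠ 0`: `k² ≥ 4`);
* `lennardJones_nonpos_of_half_le_sq_cube` — `V_LJ(r) ≤ 0` once `(r²)³ ≥ 1/2` (squared form of
  `r ≥ 2^{-1/6}`);
* `latticeSiteSum_hom_of_hcp`, `attractive_hcp`, and the theorem `halfRule_feasibleOn_hcp`: for
  `(a²)³ ≥ 1/2`, `(4h²)³ ≥ 1/2`, `(a²/3 + h²)³ ≥ 1/2` the half rule is feasible —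
  `e_∞ ≤ siteE R (1/2) x i` — at every site of every finite injective fragment `x ⊆ hcpStacking a h`, at
  EVERY radius `R`;
  `halfRule_feasibleOn_hcp_ideal` — the ideal stacking `h² = 2a²/3` needs only `a⁶ ≥ 1/2`
  (`a ≥ 2^{-1/6} ≈ 0.8909`), which covers the LP-binding member `a* = 0.9712…` (`example` below) and the
  whole scanned hcp family of the R = 2 zoo (`a ∈ [0.95, 1.06]`).

So the rows `hcp_ball_r6`, `hcp_slab…`, and every other finite piece of an ideal hcp with `a ≥ 2^{-1/6}` are
never in the hypothesis shape of `not_rungAt_of_zoo` on their own, at any rung — kernel-checked, before any LP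
is run; they matter only through keys shared with non-periodic rows (`…RadiusLadderRecurrence`).
-/

noncomputable section
namespace Summit.AtomisticToContinuum.Crystallization.Theorems.StrictSplittingRuleBirth

open scoped BigOperators Classical
open Literature.MathematicalPhysics.StatisticalMechanics

/-! ## Transport of site sums along isometric symmetries -/

/-- **Transport**: if `q ↦ p₀ + B q` (`B` a linear isometry) maps the point set onto itself, the site sum
at `p₀` is the origin site sum `Σ'_{q ∈ F+G, q ≠ 0} V_LJ(‖q‖)`. [folklore] -/
theorem latticeSiteSum_eq_originSiteSum (P : PeriodicConfiguration 3) {p₀ : EuclideanSpace ℝ (Fin 3)}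
    (B : EuclideanSpace ℝ (Fin 3) ≃ₗᵢ[ℝ] EuclideanSpace ℝ (Fin 3))
    (hB : ∀ q, q ∈ P.points ↔ p₀ + B q ∈ P.points) :
    latticeSiteSum P p₀ =
      ∑' q : {q : EuclideanSpace ℝ (Fin 3) // q ∈ P.points ∧ q ≠ 0}, lennardJones ‖q.1‖ := by
  let e : {q : EuclideanSpace ℝ (Fin 3) // q ∈ P.points ∧ q ≠ 0} ≃
      {z : EuclideanSpace ℝ (Fin 3) // z ∈ P.points ∧ z ≠ p₀} :=
    { toFun := fun q => ⟨p₀ + B q.1, (hB q.1).1 q.2.1, fun h0 => q.2.2 (by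
          have hBq : B q.1 = 0 := by simpa using h0
          exact (LinearIsometryEquiv.map_eq_zero_iff B).1 hBq)⟩
      invFun := fun z => ⟨B.symm (z.1 - p₀), (hB _).2 (by simpa using z.2.1), fun h0 => z.2.2
          (sub_eq_zero.1 ((LinearIsometryEquiv.map_eq_zero_iff B.symm).1 h0))⟩
      left_inv := fun q => Subtype.ext (by simp)
      right_inv := fun z => Subtype.ext (by simp) }
  unfold latticeSiteSum
  rw [← Equiv.tsum_eq e]
  refine tsum_congr fun q => ?_
  show lennardJones (dist p₀ (p₀ + B q.1)) = lennardJones ‖q.1‖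
  rw [dist_comm, dist_eq_norm, add_sub_cancel_left, LinearIsometryEquiv.norm_map]

/-- **Vertex-transitive ⇒ site-homogeneous**: if every point of `P` carries an isometric symmetry of the point
set moving the origin there, all motif site sums agree (the hypothesis `hhom` of `halfRule_feasibleOn_periodic`). -/
theorem latticeSiteSum_hom_of_homogeneous (P : PeriodicConfiguration 3)
    (hP : ∀ p₀ ∈ P.points, ∃ B : EuclideanSpace ℝ (Fin 3) ≃ₗᵢ[ℝ] EuclideanSpace ℝ (Fin 3),
      ∀ q, q ∈ P.points ↔ p₀ + B q ∈ P.points) :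
    ∀ y ∈ P.motif, ∀ y' ∈ P.motif, latticeSiteSum P y = latticeSiteSum P y' := by
  intro y hy y' hy'
  obtain ⟨B, hB⟩ := hP y (P.mem_points_of_mem_motif hy)
  obtain ⟨B', hB'⟩ := hP y' (P.mem_points_of_mem_motif hy')
  rw [latticeSiteSum_eq_originSiteSum P B hB, latticeSiteSum_eq_originSiteSum P B' hB']

/-- **Vertex-transitive ⇒ attractivity is a condition at the origin**: all pair distances of `P` are norms of
non-zero points of `P`. -/
theorem attractive_of_homogeneous (P : PeriodicConfiguration 3)
    (hP : ∀ p₀ ∈ P.points, ∃ B : EuclideanSpace ℝ (Fin 3) ≃ₗᵢ[ℝ] EuclideanSpace ℝ (Fin 3),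
      ∀ q, q ∈ P.points ↔ p₀ + B q ∈ P.points)
    (h0 : ∀ q ∈ P.points, q ≠ 0 → lennardJones ‖q‖ ≤ 0) :
    ∀ z ∈ P.points, ∀ z' ∈ P.points, z ≠ z' → lennardJones (dist z z') ≤ 0 := by
  intro z hz z' hz' hne
  obtain ⟨B, hB⟩ := hP z hz
  have hz'eq : z' = z + B (B.symm (z' - z)) := by simp
  have hq : B.symm (z' - z) ∈ P.points := (hB _).2 (hz'eq ▸ hz')
  have hq0 : B.symm (z' - z) ≠ 0 := fun h0 =>
    hne (sub_eq_zero.1 ((LinearIsometryEquiv.map_eq_zero_iff B.symm).1 h0)).symm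
  rw [hz'eq, dist_comm, dist_eq_norm, add_sub_cancel_left, LinearIsometryEquiv.norm_map]
  exact h0 _ hq hq0

/-- `V_LJ(r) ≤ 0` once `(r²)³ ≥ 1/2` — the attractive region `r ≥ 2^{-1/6}` in squared form. [folklore] -/
theorem lennardJones_nonpos_of_half_le_sq_cube {r : ℝ} (hr : 1 / 2 ≤ (r ^ 2) ^ 3) : lennardJones r ≤ 0 := by
  have h6 : r ^ 6 = (r ^ 2) ^ 3 := by ring
  have hr6 : 0 < r ^ 6 := by rw [h6]; linarith
  have hu2 : (r⁻¹) ^ 6 ≤ 2 := by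
    rw [inv_pow, inv_le_comm₀ hr6 (by norm_num : (0 : ℝ) < 2), h6]
    linarith
  have hu0 : 0 ≤ (r⁻¹) ^ 6 := by rw [inv_pow]; positivity
  have h12 : (r⁻¹) ^ 12 = ((r⁻¹) ^ 6) ^ 2 := by ring
  unfold lennardJones
  rw [h12]
  nlinarith

/-! ## The hexagonal close packing -/

section Hcp

variable {a h : ℝ}

/-- **Norms of hcp sites**: every non-zero site `(k, i, j)` of `hcpStacking a h` has squared norm
`≥ min (min a² (4h²)) (a²/3 + h²)` (attained: in-layer neighbours `a²`, adjacent-layer neighbours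
`a²/3 + h²`, the site two layers up `4h²`).  No hypothesis on `a, h`. [folklore] -/
theorem hcp_min_le_norm_sq (k i j : ℤ) (hne : (k, i, j) ≠ (0, 0, 0)) :
    min (min (a ^ 2) (4 * h ^ 2)) (a ^ 2 / 3 + h ^ 2) ≤ ‖barlowPos a h alternatingHagg k i j‖ ^ 2 := by
  rw [hcp_norm_sq_eq]
  rcases Int.even_or_odd k with hk | hk
  · rw [haggLabel_alternating_of_even hk]
    push_cast
    by_cases hij : (i, j) = (0, 0)
    · simp only [Prod.mk.injEq] at hij
      obtain ⟨rfl, rfl⟩ := hij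
      have hk0 : k ≠ 0 := by rintro rfl; exact hne rfl
      have hk4 : (4 : ℝ) ≤ (k : ℝ) ^ 2 := by
        obtain ⟨m, rfl⟩ := hk
        have hm : m ≠ 0 := by rintro rfl; exact hk0 (by simp)
        have h1 : (1 : ℤ) ≤ m ^ 2 := by nlinarith [Int.one_le_abs hm, sq_abs m]
        have h4 : (4 : ℤ) ≤ (m + m) ^ 2 := by nlinarith
        exact_mod_cast h4
      calc min (min (a ^ 2) (4 * h ^ 2)) (a ^ 2 / 3 + h ^ 2) ≤ 4 * h ^ 2 :=
            (min_le_left _ _).trans (min_le_right _ _)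
        _ ≤ _ := by push_cast; nlinarith [sq_nonneg h, sq_nonneg a]
    · have hform : (1 : ℝ) ≤ (i : ℝ) ^ 2 + (i : ℝ) * j + (j : ℝ) ^ 2 := by
        exact_mod_cast one_le_sq_add_mul_add_sq (p := i) (q := j) hij
      calc min (min (a ^ 2) (4 * h ^ 2)) (a ^ 2 / 3 + h ^ 2) ≤ a ^ 2 :=
            (min_le_left _ _).trans (min_le_left _ _)
        _ ≤ _ := by
            nlinarith [sq_nonneg a, sq_nonneg h, mul_nonneg (sq_nonneg (k : ℝ)) (sq_nonneg h),
              mul_nonneg (sq_nonneg a) (sub_nonneg.2 hform)]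
  · rw [haggLabel_alternating_of_odd hk]
    push_cast
    have hform : (0 : ℝ) ≤ (i : ℝ) ^ 2 + (i : ℝ) * j + (j : ℝ) ^ 2 + ((i : ℝ) + j) := by
      have key : ∀ v : ℤ, 0 ≤ 12 * v + 4 → 0 ≤ v := fun v hv => by omega
      have hv : (0 : ℤ) ≤ i ^ 2 + i * j + j ^ 2 + (i + j) :=
        key _ (by nlinarith [sq_nonneg (2 * i + j + 1), sq_nonneg (3 * j + 1)])
      exact_mod_cast hv
    have hk1 : (1 : ℝ) ≤ (k : ℝ) ^ 2 := by
      have hk0 : k ≠ 0 := by rintro rfl; simp at hk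
      have h1 : (1 : ℤ) ≤ k ^ 2 := by nlinarith [Int.one_le_abs hk0, sq_abs k]
      exact_mod_cast h1
    calc min (min (a ^ 2) (4 * h ^ 2)) (a ^ 2 / 3 + h ^ 2) ≤ a ^ 2 / 3 + h ^ 2 := min_le_right _ _
      _ ≤ _ := by
          nlinarith [sq_nonneg a, sq_nonneg h, mul_nonneg (sq_nonneg a) hform,
            mul_nonneg (sub_nonneg.2 hk1) (sq_nonneg h)]

/-- **hcp is site-homogeneous** (the hypothesis `hhom` of `halfRule_feasibleOn_periodic`, from the tree's
vertex-transitivity `hcpPeriodicConfiguration_homogeneous`). -/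
theorem latticeSiteSum_hom_of_hcp (ha : a ≠ 0) (hh : h ≠ 0) :
    ∀ y ∈ (hcpPeriodicConfiguration ha hh).motif, ∀ y' ∈ (hcpPeriodicConfiguration ha hh).motif,
      latticeSiteSum (hcpPeriodicConfiguration ha hh) y =
        latticeSiteSum (hcpPeriodicConfiguration ha hh) y' :=
  latticeSiteSum_hom_of_homogeneous _ fun _ hp₀ => hcpPeriodicConfiguration_homogeneous a h ha hh hp₀

/-- **hcp is attractive** when its three nearest squared distances `a²`, `4h²`, `a²/3 + h²` have cubes
`≥ 1/2` (all realised distances `≥ 2^{-1/6}`). -/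
theorem attractive_hcp (ha : a ≠ 0) (hh : h ≠ 0) (h1 : 1 / 2 ≤ (a ^ 2) ^ 3)
    (h2 : 1 / 2 ≤ (4 * h ^ 2) ^ 3) (h3 : 1 / 2 ≤ (a ^ 2 / 3 + h ^ 2) ^ 3) :
    ∀ z ∈ (hcpPeriodicConfiguration ha hh).points, ∀ z' ∈ (hcpPeriodicConfiguration ha hh).points,
      z ≠ z' → lennardJones (dist z z') ≤ 0 := by
  refine attractive_of_homogeneous _
    (fun _ hp₀ => hcpPeriodicConfiguration_homogeneous a h ha hh hp₀) fun q hq hq0 => ?_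
  rw [hcpPeriodicConfiguration_points] at hq
  obtain ⟨k, i, j, rfl⟩ := hq
  have hne : (k, i, j) ≠ (0, 0, 0) := by
    intro h0
    simp only [Prod.mk.injEq] at h0
    obtain ⟨rfl, rfl, rfl⟩ := h0
    exact hq0 (barlowPos_alternating_zero a h)
  have hm := hcp_min_le_norm_sq (a := a) (h := h) k i j hne
  have hm3 : 1 / 2 ≤ (min (min (a ^ 2) (4 * h ^ 2)) (a ^ 2 / 3 + h ^ 2)) ^ 3 := by
    rcases min_cases (min (a ^ 2) (4 * h ^ 2)) (a ^ 2 / 3 + h ^ 2) with ⟨e, -⟩ | ⟨e, -⟩ <;> rw [e]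
    · rcases min_cases (a ^ 2) (4 * h ^ 2) with ⟨e', -⟩ | ⟨e', -⟩ <;> rw [e']
      · exact h1
      · exact h2
    · exact h3
  have hm0 : 0 ≤ min (min (a ^ 2) (4 * h ^ 2)) (a ^ 2 / 3 + h ^ 2) :=
    le_min (le_min (sq_nonneg a) (by positivity)) (by positivity)
  exact lennardJones_nonpos_of_half_le_sq_cube (hm3.trans (pow_le_pow_left₀ hm0 hm 3))

/-- **hcp fragments never refute (half rule).**  For `(a²)³, (4h²)³, (a²/3 + h²)³ ≥ 1/2` the half rule is
feasible — `e_∞ ≤ siteE R (1/2) x i` — at every site of every finite injective fragment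
`x ⊆ hcpStacking a h`, at every radius `R`. -/
theorem halfRule_feasibleOn_hcp (ha : a ≠ 0) (hh : h ≠ 0) (h1 : 1 / 2 ≤ (a ^ 2) ^ 3)
    (h2 : 1 / 2 ≤ (4 * h ^ 2) ^ 3) (h3 : 1 / 2 ≤ (a ^ 2 / 3 + h ^ 2) ^ 3) (R : ℝ) {N : ℕ}
    {x : Fin N → EuclideanSpace ℝ (Fin 3)} (hx : Function.Injective x)
    (hxP : ∀ i, x i ∈ hcpStacking a h) (i : Fin N) : eInf ≤ siteE R halfRule x i :=
  halfRule_feasibleOn_periodic (hcpPeriodicConfiguration ha hh) (latticeSiteSum_hom_of_hcp ha hh)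
    (attractive_hcp ha hh h1 h2 h3) R hx
    (fun l => by rw [hcpPeriodicConfiguration_points]; exact hxP l) i

/-- **Ideal hcp fragments never refute**: for the ideal stacking `h² = 2a²/3` (all twelve neighbours at
distance `a`) the only condition is `a⁶ ≥ 1/2`, i.e. `a ≥ 2^{-1/6}`. -/
theorem halfRule_feasibleOn_hcp_ideal (ha : 0 < a) (hid : h ^ 2 = 2 * a ^ 2 / 3) (h1 : 1 / 2 ≤ a ^ 6)
    (R : ℝ) {N : ℕ} {x : Fin N → EuclideanSpace ℝ (Fin 3)} (hx : Function.Injective x)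
    (hxP : ∀ i, x i ∈ hcpStacking a h) (i : Fin N) : eInf ≤ siteE R halfRule x i := by
  have hh : h ≠ 0 := by
    rintro rfl
    have : a ^ 2 = 0 := by nlinarith
    exact ha.ne' (pow_eq_zero_iff (two_ne_zero) |>.1 this)
  have e1 : (a ^ 2) ^ 3 = a ^ 6 := by ring
  have e2 : (4 * h ^ 2) ^ 3 = (512 / 27) * a ^ 6 := by rw [hid]; ring
  have e3 : (a ^ 2 / 3 + h ^ 2) ^ 3 = a ^ 6 := by rw [hid]; ring
  refine halfRule_feasibleOn_hcp ha.ne' hh (by rw [e1]; exact h1) (by rw [e2]; nlinarith [h1])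
    (by rw [e3]; exact h1) R hx hxP i

/-- The LP-binding member of the R = 2 zoo, `hcp_ball_r6(a*)` with `a* = 0.9712` (RESULTS-R2 §0), lies in the
covered range: `(0.9712)⁶ ≥ 1/2`. -/
example : (1 : ℝ) / 2 ≤ ((9712 : ℝ) / 10000) ^ 6 := by norm_num

end Hcp

end Summit.AtomisticToContinuum.Crystallization.Theorems.StrictSplittingRuleBirth

end
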